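import Literature.NumberTheory.EllipticCurves.Kato2004.EulerSystemValues
import Literature.NumberTheory.GaloisRepresentations.LevelFieldLocalization
import Literature.NumberTheory.AdelicBaseChange.CompletionBaseChange
import HarnessLib

/-!
# The completions `L_w`, `w ∣ p`, of a cyclotomic level `L = ℚ(ζ_m)`, `m = p^k · ∏_{q ∈ r} ℓ_q`: the tower
# restriction `Γ_{L_w} → Γ_{ℚ_v} → Γ_ℚ` lands in the level subgroup `Gal(ℚ̄/ℚ(μ_m))`, and `p ∈ w`

Topic `NumberTheory/EllipticCurves`, sub-directory `Kato2004` (namespace = path; helper vocabulary namespace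
`EulerSystemValues` of the sibling file `EulerSystemValues`). PLUMBING for the semi-local statements of Kato,
Astérisque 295 (2004) §9.4 / Thm. 9.7 (the dual exponential of the level `ℚ(ζ_m)` is read factor by factor on
`ℚ(ζ_m) ⊗ ℚ_p = ∏_{w ∣ p} ℚ(ζ_m)_w`; Cassels–Fröhlich II §10): three PROVED lemmas, no definition, no fact,
no instance.

* `natCast_mem_asIdeal_of_extension` — for a finite place `w` of a number field `L` above a place `v` of `ℚ`
  with `p ∈ v`: `p ∈ w` (keys the `ℚ_p`-algebra / `|p|_w < 1` structures of `L_w`,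
  `LocalField.adicCompletionPadicAlgebra` / `LocalField.valuation_adicCompletion_natCast_lt_one`).
* `absGaloisRestrictTower_mem_cycSubgroup_of_dvd` — for fields `ℚ ⊆ E ⊆ F` with `F ∋` a primitive `n`-th root
  of unity and `m(k, r) ∣ n`: the tower restriction `res_{E/ℚ} ∘ res_{F/E} : Γ_F → Γ_ℚ` lands in the level
  `cycSubgroup p k r = Gal(ℚ̄/ℚ(μ_{p^k})) ⊓ ⨅_{q ∈ r} Gal(ℚ̄/ℚ(μ_{ℓ_q}))` (each factor's modulus divides `m(k, r)`;
  `LevelFieldLocalization.absGaloisRestrictTower_mem_rootsOfUnityFixer_of_dvd`).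
* `absGaloisRestrictTower_adicCompletion_mem_cycSubgroup` — the same for the completion `F = L_w` of a number
  field `L ∋ ζ_n` at any finite place `w` above a place `v` of `ℚ`, `E = ℚ_v` (the `ℚ_v`-algebra structure of
  `L_w` is the tree's `CompletionBaseChange` one; `IsScalarTower ℚ ℚ_v L_w` holds because ring maps out of `ℚ`
  are unique), and `absGaloisRestrictTower_cyclotomicField_adicCompletion_mem_cycSubgroup`, its instance at
  `L = ℚ(ζ_{m(k,r)})` (`IsCyclotomicExtension.zeta`).

These are the membership witnesses needed to evaluate a level cocycle (a crossed homomorphism of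
`Gal(ℚ̄/ℚ(μ_m))`) on the tower restriction of `σ ∈ Γ_{L_w}` — the currency of the cell `bsd-addord`'s
semi-local `exp*` clauses (Summits twins, at `p = 3` / `v = v_p`: w2-acc5
`KimAtThreeFineKatoLevelCompat.absGaloisRestrictTower_mem_cycSubgroup`, kim3
`KimAtThreeFineKatoPerFactorDefined.absGaloisRestrictTower_adicCompletion_mem_cycSubgroup`,
`KimAtThreeFineKatoDefinedLambdaDefs.prime_mem_asIdeal_extension`), stated here for a general place `v`, a
general number field `L ∋ ζ_n` and `m(k, r) ∣ n`.

References: K. Rubin, *Euler Systems* (2000), Ch. III §2.1 (the level fields `ℚ(μ_m)`) [Rubin2000];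
J. Neukirch, *Algebraic Number Theory* (1999), Ch. II §9 Prop. (9.6), Ch. IV §1 [NeukirchANT1999];
J. W. S. Cassels, A. Fröhlich (1967), Ch. II §10 [CasselsFrohlichANT1967].
-/

noncomputable section

open scoped NumberField
open Field IsDedekindDomain NumberField
open Literature.NumberTheory.GaloisRepresentations

namespace Literature.NumberTheory.EllipticCurves.Kato2004.EulerSystemValues

/-! ### `p ∈ w` for a place `w` above `v ∋ p` -/

/-- **`p ∈ w`** for a finite place `w` of a number field `L` lying above a place `v` of `ℚ` with `p ∈ v`
(`w.under 𝓞_ℚ = v`, so `algebraMap 𝓞_ℚ 𝓞_L p ∈ w`). [cite: NeukirchANT1999, Ch. II §9 Prop. (9.6)] -/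
theorem natCast_mem_asIdeal_of_extension {L : Type*} [Field L] [NumberField L] (p : ℕ)
    (v : HeightOneSpectrum (𝓞 ℚ)) (hv : ((p : ℕ) : 𝓞 ℚ) ∈ v.asIdeal) (w : v.Extension (𝓞 L)) :
    ((p : ℕ) : 𝓞 L) ∈ w.1.asIdeal := by
  have h1 := w.2
  rw [HeightOneSpectrum.ext_iff] at h1
  rw [← h1] at hv
  change ((p : ℕ) : 𝓞 ℚ) ∈ Ideal.comap (algebraMap (𝓞 ℚ) (𝓞 L)) w.1.asIdeal at hv
  rw [Ideal.mem_comap, map_natCast] at hv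
  exact hv

/-! ### Tower restrictions of a field containing `ζ_n`, `m(k, r) ∣ n`, land in the level `cycSubgroup p k r` -/

section Level

variable (p : ℕ) [hp : Fact p.Prime] (k : ℕ) (r : Finset (HeightOneSpectrum (𝓞 ℚ)))

/-- **If `F ∋` a primitive `n`-th root of unity and `m(k, r) = p^k · ∏_{q∈r} ℓ_q` divides `n`, the tower
restriction `Γ_F → Γ_E → Γ_ℚ` lands in the level `cycSubgroup p k r`** (`= Gal(ℚ̄/ℚ(μ_{p^k})) ⊓ ⨅_q
Gal(ℚ̄/ℚ(μ_{ℓ_q}))`; each factor's modulus divides `m(k, r) ∣ n`). [cite: Rubin2000, Ch. III §2.1]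
[cite: NeukirchANT1999, Ch. IV §1] -/
theorem absGaloisRestrictTower_mem_cycSubgroup_of_dvd (E F : Type) [Field E] [Field F] [Algebra ℚ E]
    [Algebra E F] [Algebra ℚ F] [IsScalarTower ℚ E F] {n : ℕ} [NeZero n] {ζ : F}
    (hζ : IsPrimitiveRoot ζ n) (hn : cycLevel p k r ∣ n) (σ : absoluteGaloisGroup F) :
    absGaloisRestrictTower ℚ E F σ ∈ cycSubgroup p k r := by
  change _ ∈ (cyclotomicLevelsRat p (∅ : Set (HeightOneSpectrum (𝓞 ℚ)))).level k r
  rw [cyclotomicLevelsRat_level]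
  refine ⟨absGaloisRestrictTower_mem_rootsOfUnityFixer_of_dvd ℚ E F hζ ((Dvd.intro _ rfl).trans hn) σ, ?_⟩
  refine Subgroup.mem_iInf.2 fun q => Subgroup.mem_iInf.2 fun hq => ?_
  exact absGaloisRestrictTower_mem_rootsOfUnityFixer_of_dvd ℚ E F hζ
    (((Finset.dvd_prod_of_mem _ hq).mul_left _).trans hn) σ

/-- **The tower restriction `Γ_{L_w} → Γ_{ℚ_v} → Γ_ℚ` of the completion of a number field `L ∋ ζ_n` at a
finite place `w` above `v` lands in the level `cycSubgroup p k r` when `m(k, r) ∣ n`** (`L_w ∋ ζ_n`, the image of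
`ζ_n` under the injective `L → L_w`; `IsScalarTower ℚ ℚ_v L_w` because ring maps out of `ℚ` are unique).
[cite: Rubin2000, Ch. III §2.1] [cite: NeukirchANT1999, Ch. II §9 Prop. (9.6)] -/
theorem absGaloisRestrictTower_adicCompletion_mem_cycSubgroup {L : Type} [Field L] [NumberField L]
    {n : ℕ} [NeZero n] {ζ : L} (hζ : IsPrimitiveRoot ζ n) (hn : cycLevel p k r ∣ n)
    (v : HeightOneSpectrum (𝓞 ℚ)) (w : v.Extension (𝓞 L)) (σ : absoluteGaloisGroup (w.1.adicCompletion L)) :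
    absGaloisRestrictTower ℚ (v.adicCompletion ℚ) (w.1.adicCompletion L) σ ∈ cycSubgroup p k r := by
  have hcomp : algebraMap ℚ (w.1.adicCompletion L) =
      (algebraMap (v.adicCompletion ℚ) (w.1.adicCompletion L)).comp (algebraMap ℚ (v.adicCompletion ℚ)) :=
    Subsingleton.elim _ _
  haveI hST : IsScalarTower ℚ (v.adicCompletion ℚ) (w.1.adicCompletion L) := IsScalarTower.of_algebraMap_eq' hcomp
  exact absGaloisRestrictTower_mem_cycSubgroup_of_dvd p k r _ _
    (hζ.map_of_injective (algebraMap L (w.1.adicCompletion L)).injective) hn σ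

set_option backward.isDefEq.respectTransparency false in
/-- **The tower restriction `Γ_{ℚ(ζ_m)_w} → Γ_{ℚ_v} → Γ_ℚ` lands in `Gal(ℚ̄/ℚ(μ_m))`, `m = m(k, r)`**, for every
finite place `w` of the cyclotomic level `ℚ(ζ_m) = CyclotomicField (cycLevel p k r) ℚ` above a place `v` of `ℚ`
(the previous lemma at `ζ := IsCyclotomicExtension.zeta`, `n := m(k, r)`). [cite: Rubin2000, Ch. III §2.1] -/
theorem absGaloisRestrictTower_cyclotomicField_adicCompletion_mem_cycSubgroup (v : HeightOneSpectrum (𝓞 ℚ))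
    (w : v.Extension (𝓞 (CyclotomicField (cycLevel p k r) ℚ)))
    (σ : absoluteGaloisGroup (w.1.adicCompletion (CyclotomicField (cycLevel p k r) ℚ))) :
    absGaloisRestrictTower ℚ (v.adicCompletion ℚ) (w.1.adicCompletion (CyclotomicField (cycLevel p k r) ℚ)) σ ∈
      cycSubgroup p k r :=
  absGaloisRestrictTower_adicCompletion_mem_cycSubgroup p k r
    (IsCyclotomicExtension.zeta_spec (cycLevel p k r) ℚ (CyclotomicField (cycLevel p k r) ℚ)) dvd_rfl v w σ

end Level

end Literature.NumberTheory.EllipticCurves.Kato2004.EulerSystemValues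

end
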